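import Mathlib
import Literature.Probability.LatticeModels.PlanarIsingTwoPointProofs
import Literature.Probability.RandomPlanarGeometry.HullSubdomainPullback
import HarnessLib

/-!
# PlanarIsingFreeTwoPointJordan

Topic `Literature/Probability/LatticeModels`. Named literature fact(s) relocated by the gate from `Summits/CriticalPhenomena/SAWScalingLimit/Theorems/SAWLoopFugacityFlowIsingBoundaryRatioBulkFreeRatio.lean`
(accept-time relocation of `[cite]`d propositions written inline in a Summits proposal; human ruling 2026-08-15).
Sources: ChelkakHonglerIzyurovAnnals2015.

* `Literature.Probability.LatticeModels.chi_twoPoint_free_jordan`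
-/

namespace Literature.Probability.LatticeModels

open scoped Classical Topology ComplexConjugate
open MeasureTheory Filter Set Function Metric Complex
open Literature.Probability.LatticeModels Literature.Probability.RandomPlanarGeometry
open UpperHalfPlane (upperHalfPlaneSet isOpen_upperHalfPlaneSet)

/-- **CHI Theorem 1.1, free boundary conditions, `ϱ`-normalised, for the canonical discretisation of a
Jordan domain.** Chelkak–Hongler–Izyurov prove (Thm. 1.1 with eqs. (1.2)–(1.3)): for a bounded simply
connected `Ω` and simply connected discrete domains `Ω_δ` (unions of faces of the square grid, §2.1)
approximating `Ω` — `∂Ω_δ → ∂Ω` in the Hausdorff sense (§2.6: "our proofs can be easily generalized for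
the Carathéodory convergence"), the particular choice of lattice approximation playing no role (§2.9,
end of the proof of Thm. 1.1) —
`ϱ(δ)⁻¹ · 𝔼^free_{Ω_δ}[σ_a σ_b] → ⟨σ_aσ_b⟩^free_Ω` as `δ → 0`, uniformly over `a, b` at distance `≥ ε`
from `∂Ω` and from each other; here `ϱ(δ) = 𝔼_{ℂ_δ}[σ_0σ_1]` is the critical full-plane two-point
function at distance `1` (`rhoCHI`) and, for any conformal bijection `ψ : Ω → ℍ`,
`⟨σ_aσ_b⟩^free_Ω = ⟨σ_{ψa}σ_{ψb}⟩^free_ℍ · |ψ'(a)|^{1/8} |ψ'(b)|^{1/8}`,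
`⟨σ_aσ_b⟩^free_ℍ = √(u_{ab}⁻¹ - u_{ab}) / ((2 Im a)^{1/8} (2 Im b)^{1/8})`, `u_{ab} = |(b-a)/(b-ā)|^{1/2}`
(`twoPointFreeCHI ψ a b`; independent of the chart `ψ` by Möbius invariance). Vendored here POINTWISE
in `(z, w)`, for a (bounded) JORDAN domain `Ω` and the tree's canonical discretisation: the main
component `Ω_δ = discreteDomainGraph Ω δ` of `δℤ² ∩ Ω` (bonds = lattice edges whose closed segment
stays in `Ω̄`), ALL its sites free (volume `meshDomainFinset Ω δ`, free boundary conditions, `h = 0`,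
`β = β_c = ½ log (1 + √2)`), marked sites `[z/δ], [w/δ]` (`nearestSite`). Transport to the tree's
conventions — the modelling content of this vendored statement: (i) the `ϱ`-normalisation is
scale-free, so CHI's `45°`-rotated face lattice may be replaced by `δℤ²` (as in `chi_onePoint_rho`);
(ii) CHI's discretisations are simply connected unions of faces carrying all nearest-neighbour bonds,
whereas `Ω_δ` is the main component of `δℤ² ∩ Ω` with the bonds leaving `Ω̄` dropped: for a Jordan
domain (`∂Ω = ∂(ext Ω)`, locally connected boundary) the polygon of `Ω_δ` approximates `Ω` in the
Hausdorff sense and, by Griffiths' second inequality, its free two-point function lies between those of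
the unions of faces "sites of `Ω_δ` at distance `≥ ε_δ` from `∂Ω`" (`ε_δ → 0` slowly) and "`Ω_δ` with
its sub-mesh holes filled and all bonds restored", two approximating families in CHI's sense ("the
convergence … is independent of the particular choice of lattice approximations", §2.9);
(iii) pointwise in `(z, w)` instead of uniform. The tree's `chi_onePoint_rho` /
`chi_twoPoint_rho_of_ratios` state the sibling results for the discretisation `meshInteriorFinset` (one
boundary layer less) under the hypothesis `MeshApproximates`; here the free two-point function is taken
with all sites of `Ω_δ` free.
TODO(general form): CHI prove the statement for every approximating family of simply connected
discrete domains, uniformly in `(a, b)`; only the canonical family of a Jordan domain, pointwise, is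
stated.
[cite: ChelkakHonglerIzyurovAnnals2015, Thm. 1.1 (free boundary conditions) with eqs. (1.2)–(1.3); §2.6 (conventions), §2.9 (end of proof of Thm. 1.1)]
[file Probability/LatticeModels/PlanarIsingFreeTwoPointJordan] -/
def chi_twoPoint_free_jordan : Prop :=
  ∀ (Ω : Literature.Probability.RandomPlanarGeometry.JordanDomain) (ψ : ℂ → ℂ),
    IsConformalBijection ψ Ω.carrier UpperHalfPlane.upperHalfPlaneSet →
      ∀ z ∈ Ω.carrier, ∀ w ∈ Ω.carrier, z ≠ w →
        Tendsto (fun δ : ℝ => isingTwoPoint (discreteDomainGraph Ω.carrier δ)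
            (meshDomainFinset Ω.carrier δ) criticalBetaTwo 0 BoundaryCondition.free
            (nearestSite δ z) (nearestSite δ w) / rhoCHI δ)
          (𝓝[>] 0) (𝓝 (twoPointFreeCHI ψ z w))

end Literature.Probability.LatticeModels
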